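import Summits.CriticalPhenomena.SAWScalingLimit.Theorems.SAWLoopFugacityFlowAvoidanceLimitHarmonicExitRepresentation

/-!
# Last-exit decomposition of the killed Green's function across a sub-region
— UBHP brick B-lastexit of line `symplectic-fermion-anchor`
(crux `SAWLoopFugacityFlow.AvoidanceLimit`, stmt-CriticalPhenomena-10649)

For the EDGE-killed simple random walk of a subgraph `H ≤ ℤ²` on a finite vertex set `T`
(transition matrix `P = ¼·adjMat H T`, Green's function `G_T = greenEntry H T = (1 − P)⁻¹`) and a
sub-region `T' ⊆ T`, every walk from `u ∈ T'` to `w ∈ T ∖ T'` inside `T` splits at its LAST visit to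
`T'`; after that visit the walk makes one `H`-step into `T ∖ T'` and then stays in `T ∖ T'`:

* `greenEntry_lastExit` (registered signature) —
  `G_T(u, w) = Σ_{u' ∈ T'} G_T(u, u') · ¼ Σ_{v ∈ T ∖ T', v ∼_H u'} G_{T∖T'}(v, w)`.

This is the `Z_Θ(u,u') Z_Λ(u',x)` factorisation in the proof of the boundary Harnack contraction
(Chelkak–Wan 2021, Lemma 3.7), for the tree's edge-killed walk. The proof here does no path counting:
the Green COLUMN `y ↦ G_T(y, u)` with pole `u ∈ T'` is `P`-harmonic on `T ∖ T'` (first-step identity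
`greenEntry_first_step` off the pole), so the landed exit representation
`transitionHarmonic_eq_sum_greenEntry_mul` on the sub-region `T ∖ T' ⊆ T` expresses `G_T(w, u)` through
`G_{T∖T'}(w, ·)` and the values of the column on `T'`; the symmetry `greenEntry_comm` of both Green's
functions and a reordering of the two finite sums give the displayed form.

Sources: G. F. Lawler, *Intersections of Random Walks* (1991), §1.4–1.5 [Lawler1991]; D. Chelkak,
Y. Wan, Electron. J. Probab. 26 (2021), §3.2 [ChelkakWan2021]; folklore linear algebra.
No definitions.
-/

noncomputable section

open scoped BigOperators Classical
open Finset Matrix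
open Literature.Probability.RandomPlanarGeometry Literature.Probability.LatticeModels

namespace Summit.CriticalPhenomena.SAWScalingLimit.Theorems.AvoidanceLimit.Anchor

open KilledGreen

/-! ## The Green column is harmonic off its pole -/

/-- **The Green column `y ↦ G_T(y, u)` is `P_{H|T}`-harmonic at every `x ∈ T` with `x ≠ u`**: the
first-step identity `G(x,u) = [x = u] + ¼ Σ_{z ∈ T, z ∼_H x} G(z,u)` with the Kronecker term absent.
[cite: Lawler1991, §1.5] -/
theorem transition_mulVec_greenEntry_col_eq {H : SimpleGraph (Site 2)} (hH : H ≤ zdGraph 2)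
    (T : Finset (Site 2)) {u : Site 2} (hu : u ∈ T) (x : ↥T) (hxu : (x : Site 2) ≠ u) :
    Matrix.mulVec ((4 : ℝ)⁻¹ • adjMat H T) (fun y : ↥T => greenEntry H T y u) x =
      greenEntry H T x u := by
  rw [transition_mulVec_eq_sum_filter_dite, greenEntry_first_step hH T x.2 hu, if_neg hxu, zero_add]
  congr 1
  refine Finset.sum_congr rfl fun z hz => ?_
  rw [dif_pos (Finset.mem_filter.1 hz).1]

/-! ## Bookkeeping of the boundary sum -/

/-- The vertices of `T` outside `T ∖ T'` that are `H`-adjacent to `v` are the vertices of `T' ⊆ T`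
adjacent to `v`. [folklore] -/
theorem filter_not_mem_sdiff_and_adj_eq {H : SimpleGraph (Site 2)} {T T' : Finset (Site 2)}
    (hT'T : T' ⊆ T) (v : Site 2) :
    T.filter (fun z => z ∉ T \ T' ∧ H.Adj v z) = T'.filter (fun z => H.Adj v z) := by
  ext z
  simp only [Finset.mem_filter, Finset.mem_sdiff, not_and, not_not]
  exact ⟨fun h => ⟨h.2.1 h.1, h.2.2⟩, fun h => ⟨hT'T h.1, fun _ => h.1, h.2⟩⟩

/-- The boundary term of the exit representation on the sub-region `T ∖ T'`, for the Green column
with pole `u`: `Σ_{x ∈ T, x ∉ T ∖ T', x ∼_H v} G_T(x,u) = Σ_{x ∈ T', x ∼_H v} G_T(x,u)`. [folklore] -/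
theorem sum_filter_univ_greenEntry_col_eq (H : SimpleGraph (Site 2)) {T T' : Finset (Site 2)}
    (hT'T : T' ⊆ T) (u v : Site 2) :
    ∑ x ∈ (Finset.univ : Finset ↥T).filter
        (fun x : ↥T => (x : Site 2) ∉ T \ T' ∧ H.Adj v (x : Site 2)), greenEntry H T x u =
      ∑ x ∈ T'.filter (fun x => H.Adj v x), greenEntry H T x u := by
  rw [sum_filter_univ_eq_sum_filter_dite T (fun z => z ∉ T \ T' ∧ H.Adj v z)
    (fun y : ↥T => greenEntry H T y u), filter_not_mem_sdiff_and_adj_eq hT'T v]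
  refine Finset.sum_congr rfl fun z hz => ?_
  rw [dif_pos (hT'T (Finset.mem_filter.1 hz).1)]

/-! ## Registered brick B-lastexit -/

/-- **Registered brick B-lastexit: last-exit decomposition of the killed Green's function across a
sub-region.** For every subgraph `H ≤ ℤ²`, finite vertex sets `T' ⊆ T`, `u ∈ T'` and `w ∈ T ∖ T'`,
`G_T(u, w) = Σ_{u' ∈ T'} G_T(u, u') · ¼ Σ_{v ∈ T ∖ T', v ∼_H u'} G_{T∖T'}(v, w)`,
where `G_Λ = greenEntry H Λ` is the Green's function of the walk on `ℤ²` killed at its first step that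
is not an `H`-edge between `Λ`-sites (split every walk `u → w` inside `T` at its last visit to `T'`).
Proof: the exit representation `transitionHarmonic_eq_sum_greenEntry_mul` on `T ∖ T' ⊆ T` applied to
the Green column `y ↦ G_T(y, u)` (harmonic off its pole `u ∉ T ∖ T'`), then the symmetry
`greenEntry_comm` of `G_T` and `G_{T∖T'}` and a reordering of the two finite sums (the `Z_Θ Z_Λ`
factorisation in the proof of Chelkak–Wan 2021, Lemma 3.7, for the tree's edge-killed walk).
[cite: Lawler1991, §1.5] -/
theorem greenEntry_lastExit :
    ∀ (H : SimpleGraph (Site 2)), H ≤ zdGraph 2 → ∀ (T T' : Finset (Site 2)), T' ⊆ T → ∀ (u w : Site 2), u ∈ T' → w ∈ T → w ∉ T' → greenEntry H T u w = ∑ u' ∈ T', greenEntry H T u u' * ((4 : ℝ)⁻¹ * ∑ v ∈ (T \ T').filter (fun v => H.Adj u' v), greenEntry H (T \ T') v w) := by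
  intro H hH T T' hT'T u w hu hw hwT'
  have huT : u ∈ T := hT'T hu
  have hwS : w ∈ T \ T' := Finset.mem_sdiff.2 ⟨hw, hwT'⟩
  -- the Green column with pole `u` is harmonic on `T ∖ T'` (its pole lies in `T'`)
  have hharm : ∀ x : ↥T, (x : Site 2) ∈ T \ T' →
      Matrix.mulVec ((4 : ℝ)⁻¹ • adjMat H T) (fun y : ↥T => greenEntry H T y u) x =
        (fun y : ↥T => greenEntry H T y u) x := fun x hx =>
    transition_mulVec_greenEntry_col_eq hH T huT x fun h => (Finset.mem_sdiff.1 hx).2 (h ▸ hu)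
  -- exit representation of the column on the sub-region `T ∖ T'`, read at `w`
  have key : greenEntry H T w u = ∑ v ∈ T \ T', greenEntry H (T \ T') w v *
      ((4 : ℝ)⁻¹ * ∑ x ∈ (Finset.univ : Finset ↥T).filter
        (fun x : ↥T => (x : Site 2) ∉ T \ T' ∧ H.Adj v (x : Site 2)), greenEntry H T x u) :=
    transitionHarmonic_eq_sum_greenEntry_mul H hH T (T \ T') Finset.sdiff_subset
      (fun y : ↥T => greenEntry H T y u) hharm ⟨w, hw⟩ hwS
  -- symmetrise and reorder the two finite sums
  calc greenEntry H T u w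
      = greenEntry H T w u := greenEntry_comm hH T u w
    _ = ∑ v ∈ T \ T', greenEntry H (T \ T') w v *
          ((4 : ℝ)⁻¹ * ∑ x ∈ T'.filter (fun x => H.Adj v x), greenEntry H T x u) := by
        rw [key]
        refine Finset.sum_congr rfl fun v _ => ?_
        rw [sum_filter_univ_greenEntry_col_eq H hT'T u v]
    _ = ∑ v ∈ T \ T', ∑ x ∈ T',
          (if H.Adj v x then greenEntry H T u x * ((4 : ℝ)⁻¹ * greenEntry H (T \ T') v w)
            else 0) := by
        refine Finset.sum_congr rfl fun v _ => ?_
        rw [Finset.sum_filter, Finset.mul_sum, Finset.mul_sum]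
        refine Finset.sum_congr rfl fun x _ => ?_
        by_cases hvx : H.Adj v x
        · rw [if_pos hvx, if_pos hvx, greenEntry_comm hH (T \ T') w v, greenEntry_comm hH T x u]
          ring
        · rw [if_neg hvx, if_neg hvx, mul_zero, mul_zero]
    _ = ∑ x ∈ T', ∑ v ∈ T \ T',
          (if H.Adj x v then greenEntry H T u x * ((4 : ℝ)⁻¹ * greenEntry H (T \ T') v w)
            else 0) := by
        rw [Finset.sum_comm]
        refine Finset.sum_congr rfl fun x _ => Finset.sum_congr rfl fun v _ => ?_
        rw [if_congr (H.adj_comm v x) rfl rfl]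
    _ = ∑ u' ∈ T', greenEntry H T u u' *
          ((4 : ℝ)⁻¹ * ∑ v ∈ (T \ T').filter (fun v => H.Adj u' v), greenEntry H (T \ T') v w) := by
        refine Finset.sum_congr rfl fun x _ => ?_
        rw [Finset.sum_filter, Finset.mul_sum, Finset.mul_sum]
        refine Finset.sum_congr rfl fun v _ => ?_
        by_cases hxv : H.Adj x v
        · rw [if_pos hxv, if_pos hxv]
        · rw [if_neg hxv, if_neg hxv, mul_zero, mul_zero]

end Summit.CriticalPhenomena.SAWScalingLimit.Theorems.AvoidanceLimit.Anchor

end
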